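import Mathlib
import HarnessLib
import Literature.Probability.MarkovChains.CheegerInequality

/-!
# The restricted Cheeger inequality `Φ²(π(A))/2 ≤ λ₀(A)`: the Dirichlet form of a function supported in `A` against the conductance of the subsets of `A` (Goel–Montenegro–Tetali 2006, Lemma 2.4, lower bound)

HONEST FRAMING: exact (Metropolis-corrected) sampling algorithms for lattice gauge theory; figures
of merit are autocorrelation/cost numbers at stated couplings and volumes; no continuum-physics claim.

Source (READ on the hub's materialised text): S. Goel, R. Montenegro, P. Tetali, *Mixing time
bounds via the spectral profile*, Electron. J. Probab. **11** (2006) 1–26 = math.PR/0505690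
[GoelMontenegroTetali2006], §2.2: DEFINITION 2.1 (`Q(A,B)`, `|∂S| = Q(S,Sᶜ)`, `Q(S,Sᶜ) =
Q(Sᶜ,S)`), LEMMA 2.4 and its proof — eq. (level) `π(f) = ∫₀^∞ π(F_t)dt`, the discrete CO-AREA
FORMULA eq. (coarea) `Σ_{x,y}|f(x) − f(y)|Q(x,y) = 2∫₀^∞|∂F_t|dt`, "for non-negative `f ∈ c₀(A)`,
`F_t ⊂ A` for `t > 0`, and so `Σ_{x,y}|f(x) − f(y)|Q(x,y) ≥ 2Φ(π(A))π(f)`", the Cauchy–Schwarz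
display `2Φ(π(A))π(f²) ≤ (2𝓔(f,f))^{1/2}(4π(f²))^{1/2}`, and "`λ₀(A) ≥ Φ²(π(A))/2` … for general
`f ∈ c₀(A)`, `𝓔(f,f) ≥ 𝓔(|f|,|f|) and `π(f²) = π(|f|²)`".  Everything below is PROVED (finite sums;
0 named facts).  The level-set integrals are evaluated as finite sums exactly as in the tree's
`CheegerInequality.lean` (LEMMA 13.13 of Levin–Peres–Wilmer, the unrestricted case `π{ψ > 0} ≤ ½`
with the global constant `Φ⋆`): an induction on the number of points where `ψ > 0`, peeling off
the lowest positive level.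

SET FORM.  The printed constant is `Φ(π(A)) = inf{|∂S|/π(S) : π(S) ≤ π(A)}`, and the proof uses it
only through `|∂F_t| ≥ Φ(π(A))π(F_t)` for the level sets `F_t ⊆ A`.  The theorems below therefore
take ANY `h` with **`h·π(S) ≤ Q(S,Sᶜ)` for every `S ⊆ A`** (e.g. `h = Φ(π(A))`, or the larger
`inf_{S ⊆ A}|∂S|/π(S)`) and conclude **`(h²/2)‖f‖₂² ≤ 𝓔(f,f)` for every `f` supported in `A`** — i.e.
`λ₀(A) ≥ h²/2` for the variational Dirichlet eigenvalue `λ₀(A) = inf_{f ∈ c₀(A)}𝓔(f,f)/‖f‖₂²` of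
`SpectralProfile.lean` (not imported; that file and the conductance profile `Φ(r)` have no built
module yet, so the one-line specialisations `Φ(π(A))²/2 ≤ λ₀(A)` and `Φ(r)²/2 ≤ Λ(r)` are left to
the importer).  Conventions: `Q(x,y) = π(x)P(x,y)`, `edgeMeasure π P A B = Q(A,B)`, `dirichletForm
π P f = 𝓔(f,f) = ½Σ_{x,y}π(x)P(x,y)(f(x) − f(y))²`, `piInner`, `lawMean` (`BottleneckRatio.lean`,
`PeskunOrdering.lean`); `P` row-stochastic with `πP = π` where said — reversibility is not used
(`Q(S,Sᶜ) = Q(Sᶜ,S)` is stationarity, `edgeMeasure_compl_comm`).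

## Content
* `coarea_induction_subset` — the co-area bound with cuts restricted to subsets of `A`: if
  `K·π(S) ≤ Σ_{x∈S,y∉S}w(x,y)` for all `S ⊆ A`, then `K·E_π(ψ) ≤ Σ_{x,y}w(x,y)max(ψ(x) − ψ(y),0)` for
  every `ψ ≥ 0` supported in `A`;
* `GoelMontenegroTetali2006_coarea_lower`, `_rev`, `_abs` — eq. (coarea)/(level) consequence
  **`h·E_π(ψ) ≤ ½Σ_{x,y}Q(x,y)|ψ(x) − ψ(y)|`** for `ψ ≥ 0` supported in `A`;
* `dirichletForm_abs_le` — LEMMA 2.3, second inequality `𝓔(f,f) ≥ 𝓔(|f|,|f|)`;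
* `sq_setConductance_mul_sq_piInner_le` — the Cauchy–Schwarz display `h²‖f‖₂⁴ ≤ 𝓔(f)(2‖f‖₂² − 𝓔(f))`
  for `f ≥ 0` supported in `A`; **LEMMA 2.4 (lower bound, set form)**
  `GoelMontenegroTetali2006_lemma_2_4_lower_nonneg` / `GoelMontenegroTetali2006_lemma_2_4_lower`:
  **`(h²/2)‖f‖₂² ≤ 𝓔(f,f)`** for every `f` (resp. `f ≥ 0`) supported in `A`.

Context (cell pub-lqcd, venture LatticeQCDFlow; value-free): with the conductance profile this is
the device turning isoperimetry of SMALL sets into the Faber–Krahn profile `Λ(r) ≥ Φ(r)²/2` and hence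
(THEOREM 1.1 of the source) into mixing bounds sharper than the global Cheeger constant allows.
-/

namespace Literature.Probability.MarkovChains

open Finset Matrix

variable {X : Type*} [Fintype X] [DecidableEq X]

/-! ## The co-area bound with cuts inside `A` -/

omit [DecidableEq X] in
/-- `max(a,0) + max(−a,0) = |a|`. [cite: GoelMontenegroTetali2006, §2.2 proof of Lemma 2.4 (eq.
(coarea): "`Σ|f(x) − f(y)|Q(x,y) = Σ_{f(x)>f(y)}[f(x) − f(y)][Q(x,y) + Q(y,x)]`")] -/
private theorem max_zero_add_max_neg_zero' (a : ℝ) : max a 0 + max (-a) 0 = |a| := by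
  rcases le_total 0 a with h | h
  · rw [max_eq_left h, max_eq_right (neg_nonpos.mpr h), abs_of_nonneg h, add_zero]
  · rw [max_eq_right h, max_eq_left (neg_nonneg.mpr h), abs_of_nonpos h, zero_add]

/-- **The co-area bound with cuts restricted to subsets of `A`** (eqs. (level), (coarea) of the
source, evaluated as finite sums): if a weight `w` dominates `K·π` on every cut of a subset of `A`
(`K π(S) ≤ Σ_{x∈S,y∉S} w(x,y)` for all `S ⊆ A`), then `K·E_π(ψ) ≤ Σ_{x,y} w(x,y) max(ψ(x) − ψ(y), 0)`
for every `ψ ≥ 0` supported in `A` — induction on the number of points where `ψ > 0`, peeling off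
the lowest positive level ("`F_t ⊂ A` for `t > 0`"). [cite: GoelMontenegroTetali2006, §2.2 proof of
Lemma 2.4, eqs. (level)–(coarea)] -/
theorem coarea_induction_subset {π : X → ℝ} {w : X → X → ℝ} {K : ℝ}
    {A : Finset X} (hcut : ∀ S : Finset X, S ⊆ A → K * ∑ x ∈ S, π x ≤ ∑ x ∈ S, ∑ y ∈ Sᶜ, w x y) :
    ∀ (n : ℕ) (ψ : X → ℝ), (∀ x, 0 ≤ ψ x) → (univ.filter (fun x => 0 < ψ x)).card ≤ n →
      univ.filter (fun x => 0 < ψ x) ⊆ A →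
      K * ∑ x, π x * ψ x ≤ ∑ x, ∑ y, w x y * max (ψ x - ψ y) 0 := by
  intro n
  induction n with
  | zero =>
    intro ψ hψ hcard _
    have hS : univ.filter (fun x => 0 < ψ x) = ∅ := card_eq_zero.mp (Nat.le_zero.mp hcard)
    have hψ0 : ∀ x, ψ x = 0 := by
      intro x
      have hx : x ∉ univ.filter (fun x => 0 < ψ x) := by rw [hS]; exact notMem_empty x
      have : ¬ 0 < ψ x := fun h => hx (mem_filter.mpr ⟨mem_univ x, h⟩)
      exact le_antisymm (not_lt.mp this) (hψ x)
    simp [hψ0]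
  | succ n ih =>
    intro ψ hψ hcard hA
    set S := univ.filter (fun x => 0 < ψ x) with hSdef
    have hψS : ∀ x, x ∉ S → ψ x = 0 := fun x hx => by
      have : ¬ 0 < ψ x := fun h => hx (mem_filter.mpr ⟨mem_univ x, h⟩)
      exact le_antisymm (not_lt.mp this) (hψ x)
    by_cases hSe : S = ∅
    · have hψ0 : ∀ x, ψ x = 0 := fun x => hψS x (by rw [hSe]; exact notMem_empty x)
      simp [hψ0]
    · -- the lowest positive level `m = ψ x₀`
      obtain ⟨x₀, hx₀S, hmin⟩ := exists_min_image S ψ (nonempty_of_ne_empty hSe)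
      set m := ψ x₀ with hm
      have hm0 : 0 < m := (mem_filter.mp hx₀S).2
      have hmS : ∀ x, x ∈ S → m ≤ ψ x := fun x hx => hmin x hx
      -- `ψ' = ψ − m` on `S`, `0` off `S`
      set ψ' : X → ℝ := fun x => if x ∈ S then ψ x - m else 0 with hψ'
      have hψ'S : ∀ x, x ∈ S → ψ' x = ψ x - m := fun x hx => by simp only [hψ', if_pos hx]
      have hψ'nS : ∀ x, x ∉ S → ψ' x = 0 := fun x hx => by simp only [hψ', if_neg hx]
      have hψ'0 : ∀ x, 0 ≤ ψ' x := by
        intro x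
        by_cases hx : x ∈ S
        · rw [hψ'S x hx]; exact sub_nonneg.mpr (hmS x hx)
        · rw [hψ'nS x hx]
      -- the support of `ψ'` lies in `S` minus `x₀`
      have hsupp' : univ.filter (fun x => 0 < ψ' x) ⊆ S.erase x₀ := by
        intro x hx
        have hx' : 0 < ψ' x := (mem_filter.mp hx).2
        have hxS : x ∈ S := by
          by_contra h
          rw [hψ'nS x h] at hx'
          exact lt_irrefl _ hx'
        refine mem_erase.mpr ⟨?_, hxS⟩
        rintro rfl
        rw [hψ'S _ hxS, ← hm, sub_self] at hx'
        exact lt_irrefl _ hx'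
      have hcard' : (univ.filter (fun x => 0 < ψ' x)).card ≤ n := by
        have h1 := card_le_card hsupp'
        rw [card_erase_of_mem hx₀S] at h1
        have h2 : S.card ≤ n + 1 := hcard
        omega
      have hA' : univ.filter (fun x => 0 < ψ' x) ⊆ A := (hsupp'.trans (erase_subset _ _)).trans hA
      have IH := ih ψ' hψ'0 hcard' hA'
      -- the level set `S ⊆ A` itself: `K π(S) ≤ Σ_{x∈S, y∉S} w`
      have hS_cut := hcut S hA
      -- decomposition of the left side: `E_π ψ = E_π ψ' + m π(S)`
      have hL : ∑ x, π x * ψ x = ∑ x, π x * ψ' x + m * ∑ x ∈ S, π x := by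
        have h1 : ∀ x, π x * ψ x = π x * ψ' x + (if x ∈ S then m * π x else 0) := by
          intro x
          by_cases hx : x ∈ S
          · rw [hψ'S x hx, if_pos hx]; ring
          · rw [hψ'nS x hx, hψS x hx, if_neg hx]; ring
        rw [sum_congr rfl fun x _ => h1 x, sum_add_distrib, ← sum_filter, filter_mem_eq_inter,
          univ_inter, mul_sum]
      -- decomposition of the right side
      have hR : ∀ x y, max (ψ x - ψ y) 0 =
          max (ψ' x - ψ' y) 0 + (if x ∈ S then (if y ∈ S then 0 else m) else 0) := by
        intro x y
        by_cases hx : x ∈ S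
        · by_cases hy : y ∈ S
          · rw [if_pos hx, if_pos hy, hψ'S x hx, hψ'S y hy]; ring_nf
          · rw [if_pos hx, if_neg hy, hψ'S x hx, hψ'nS y hy, hψS y hy, sub_zero, sub_zero,
              max_eq_left (hψ x), max_eq_left (sub_nonneg.mpr (hmS x hx))]
            ring
        · by_cases hy : y ∈ S
          · rw [if_neg hx, hψ'nS x hx, hψS x hx, zero_sub, zero_sub, add_zero,
              max_eq_right (neg_nonpos.mpr (hψ y)), max_eq_right (neg_nonpos.mpr (hψ'0 y))]
          · rw [if_neg hx, hψ'nS x hx, hψ'nS y hy, hψS x hx, hψS y hy, add_zero]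
      have hRsum : ∑ x, ∑ y, w x y * max (ψ x - ψ y) 0 =
          ∑ x, ∑ y, w x y * max (ψ' x - ψ' y) 0 + m * ∑ x ∈ S, ∑ y ∈ Sᶜ, w x y := by
        have h1 : ∀ x, ∑ y, w x y * max (ψ x - ψ y) 0 =
            ∑ y, w x y * max (ψ' x - ψ' y) 0 +
              (if x ∈ S then m * ∑ y ∈ Sᶜ, w x y else 0) := by
          intro x
          have h2 : ∀ y, w x y * max (ψ x - ψ y) 0 = w x y * max (ψ' x - ψ' y) 0 +
              w x y * (if x ∈ S then (if y ∈ S then 0 else m) else 0) := by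
            intro y; rw [hR x y]; ring
          rw [sum_congr rfl fun y _ => h2 y, sum_add_distrib]
          congr 1
          by_cases hx : x ∈ S
          · simp_rw [if_pos hx]
            rw [← sum_add_sum_compl S (fun y => w x y * (if y ∈ S then (0:ℝ) else m))]
            have hA0 : ∑ y ∈ S, w x y * (if y ∈ S then (0:ℝ) else m) = 0 :=
              sum_eq_zero fun y hy => by rw [if_pos hy, mul_zero]
            have hB : ∑ y ∈ Sᶜ, w x y * (if y ∈ S then (0:ℝ) else m) = ∑ y ∈ Sᶜ, w x y * m :=
              sum_congr rfl fun y hy => by rw [if_neg (mem_compl.mp hy)]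
            rw [hA0, hB, zero_add, mul_sum]
            exact sum_congr rfl fun y _ => by ring
          · simp_rw [if_neg hx, mul_zero, sum_const_zero]
        rw [sum_congr rfl fun x _ => h1 x, sum_add_distrib, ← sum_filter, filter_mem_eq_inter,
          univ_inter, mul_sum]
      -- assemble
      rw [hL, hRsum, mul_add]
      have hlevel : K * (m * ∑ x ∈ S, π x) ≤ m * ∑ x ∈ S, ∑ y ∈ Sᶜ, w x y := by
        have := mul_le_mul_of_nonneg_left hS_cut hm0.le
        linarith [this]
      linarith [IH, hlevel]

/-- **Eqs. (level)–(coarea) ⇒ `h·E_π(ψ) ≤ Σ_{x,y: ψ(x)>ψ(y)}[ψ(x) − ψ(y)]Q(x,y)`** for `ψ ≥ 0`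
supported in `A`, when `h·π(S) ≤ Q(S,Sᶜ) = |∂S|` for every `S ⊆ A` ("`F_t ⊂ A` for `t > 0`, and so
… `≥ 2Φ(π(A))∫₀^∞π(F_t)dt`"; `Q(x,y) = π(x)P(x,y)`, `π ≥ 0`).
[cite: GoelMontenegroTetali2006, §2.2 proof of Lemma 2.4] -/
theorem GoelMontenegroTetali2006_coarea_lower {P : X → X → ℝ} {π : X → ℝ}
    {A : Finset X} {h : ℝ} (hcut : ∀ S : Finset X, S ⊆ A → h * ∑ x ∈ S, π x ≤ edgeMeasure π P S Sᶜ)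
    {ψ : X → ℝ} (hψ : ∀ x, 0 ≤ ψ x) (hψA : ∀ x, x ∉ A → ψ x = 0) :
    h * ∑ x, π x * ψ x ≤ ∑ x, ∑ y, π x * P x y * max (ψ x - ψ y) 0 := by
  refine coarea_induction_subset (w := fun x y => π x * P x y) (fun S hS => hcut S hS) _ ψ hψ
    le_rfl fun x hx => ?_
  by_contra hxA
  have := (mem_filter.mp hx).2
  rw [hψA x hxA] at this
  exact lt_irrefl _ this

/-- The same with the cut read from the other side (`Q(S,Sᶜ) = Q(Sᶜ,S)`, stationarity):
`h·E_π(ψ) ≤ Σ_{x,y}Q(x,y)max(ψ(y) − ψ(x),0)`. [cite: GoelMontenegroTetali2006, §2.2 Definition 2.1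
("It follows that `Q(S,Sᶜ) = Q(Sᶜ,S)`") and proof of Lemma 2.4] -/
theorem GoelMontenegroTetali2006_coarea_lower_rev {P : X → X → ℝ} (hP : IsRowStochastic P)
    {π : X → ℝ} (hst : IsStationary π P) {A : Finset X} {h : ℝ}
    (hcut : ∀ S : Finset X, S ⊆ A → h * ∑ x ∈ S, π x ≤ edgeMeasure π P S Sᶜ)
    {ψ : X → ℝ} (hψ : ∀ x, 0 ≤ ψ x) (hψA : ∀ x, x ∉ A → ψ x = 0) :
    h * ∑ x, π x * ψ x ≤ ∑ x, ∑ y, π x * P x y * max (ψ y - ψ x) 0 := by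
  have hsupp : univ.filter (fun x => 0 < ψ x) ⊆ A := fun x hx => by
    by_contra hxA
    have := (mem_filter.mp hx).2
    rw [hψA x hxA] at this
    exact lt_irrefl _ this
  have h1 := coarea_induction_subset (π := π) (w := fun x y => π y * P y x) (K := h) (A := A)
    (fun S hS => ?_) _ ψ hψ le_rfl hsupp
  · calc h * ∑ x, π x * ψ x ≤ ∑ x, ∑ y, π y * P y x * max (ψ x - ψ y) 0 := h1
      _ = ∑ x, ∑ y, π x * P x y * max (ψ y - ψ x) 0 := sum_comm
  · calc h * ∑ x ∈ S, π x ≤ edgeMeasure π P S Sᶜ := hcut S hS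
      _ = edgeMeasure π P Sᶜ S := edgeMeasure_compl_comm hP hst S
      _ = ∑ x ∈ S, ∑ y ∈ Sᶜ, π y * P y x := by unfold edgeMeasure; exact sum_comm

/-- The symmetrised form **`h·E_π(ψ) ≤ ½Σ_{x,y}Q(x,y)|ψ(x) − ψ(y)|`** (eq. (coarea): "`Σ_{x,y}|f(x) −
f(y)|Q(x,y) = 2∫₀^∞|∂F_t|dt ≥ 2Φ(π(A))π(f)`"), for `ψ ≥ 0` supported in `A`, `P` row-stochastic with
`πP = π`. [cite: GoelMontenegroTetali2006, §2.2 proof of Lemma 2.4, eq. (coarea)] -/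
theorem GoelMontenegroTetali2006_coarea_lower_abs {P : X → X → ℝ} (hP : IsRowStochastic P)
    {π : X → ℝ} (hst : IsStationary π P) {A : Finset X} {h : ℝ}
    (hcut : ∀ S : Finset X, S ⊆ A → h * ∑ x ∈ S, π x ≤ edgeMeasure π P S Sᶜ)
    {ψ : X → ℝ} (hψ : ∀ x, 0 ≤ ψ x) (hψA : ∀ x, x ∉ A → ψ x = 0) :
    h * ∑ x, π x * ψ x ≤ (1 / 2) * ∑ x, ∑ y, π x * P x y * |ψ x - ψ y| := by
  have h1 := GoelMontenegroTetali2006_coarea_lower hcut hψ hψA (P := P)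
  have h2 := GoelMontenegroTetali2006_coarea_lower_rev hP hst hcut hψ hψA
  have hsum : ∑ x, ∑ y, π x * P x y * max (ψ x - ψ y) 0 +
      ∑ x, ∑ y, π x * P x y * max (ψ y - ψ x) 0 = ∑ x, ∑ y, π x * P x y * |ψ x - ψ y| := by
    rw [← sum_add_distrib]
    refine sum_congr rfl fun x _ => ?_
    rw [← sum_add_distrib]
    refine sum_congr rfl fun y _ => ?_
    rw [← mul_add, ← max_zero_add_max_neg_zero' (ψ x - ψ y), neg_sub]
  linarith

/-! ## The Cauchy–Schwarz step and Lemma 2.4 (lower bound) -/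

omit [DecidableEq X] in
/-- **LEMMA 2.3, second inequality: `𝓔(f,f) ≥ 𝓔(|f|,|f|)`** (pointwise `(a − b)² ≥ (|a| − |b|)²`;
`π, K ≥ 0`). [cite: GoelMontenegroTetali2006, §2.1 Lemma 2.3] -/
theorem dirichletForm_abs_le {π : X → ℝ} (hπ0 : ∀ x, 0 ≤ π x) {P : Matrix X X ℝ}
    (hP0 : ∀ x y, 0 ≤ P x y) (f : X → ℝ) :
    dirichletForm π P (fun x => |f x|) ≤ dirichletForm π P f := by
  unfold dirichletForm
  refine mul_le_mul_of_nonneg_left (sum_le_sum fun x _ => sum_le_sum fun y _ => ?_) (by norm_num)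
  refine mul_le_mul_of_nonneg_left ?_ (mul_nonneg (hπ0 x) (hP0 x y))
  rw [← sq_abs (|f x| - |f y|), ← sq_abs (f x - f y)]
  exact pow_le_pow_left₀ (abs_nonneg _) (abs_abs_sub_abs_le_abs_sub (f x) (f y)) 2

/-- The Cauchy–Schwarz display of the proof: for `f ≥ 0` supported in `A`, **`h²⟨f,f⟩²_π ≤
𝓔(f)[2⟨f,f⟩_π − 𝓔(f)]`** ("`2Φ(π(A))π(f²) ≤ Σ|f²(x) − f²(y)|Q(x,y) = Σ|f(x) − f(y)|(f(x) + f(y))Q(x,y)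
≤ (Σ(f(x) − f(y))²Q)^{1/2}(Σ(f(x) + f(y))²Q)^{1/2}`", with `Σ(f(x)+f(y))²Q = 4π(f²) − 2𝓔(f,f)` kept
instead of the bound `≤ 4π(f²)`).  `P` row-stochastic, `πP = π`, `π ≥ 0`.
[cite: GoelMontenegroTetali2006, §2.2 proof of Lemma 2.4 (lower bound)] -/
theorem sq_setConductance_mul_sq_piInner_le {P : X → X → ℝ} (hP : IsRowStochastic P)
    {π : X → ℝ} (hst : IsStationary π P) (hπ0 : ∀ x, 0 ≤ π x) {A : Finset X} {h : ℝ}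
    (hh : 0 ≤ h) (hcut : ∀ S : Finset X, S ⊆ A → h * ∑ x ∈ S, π x ≤ edgeMeasure π P S Sᶜ)
    {f : X → ℝ} (hf : ∀ x, 0 ≤ f x) (hfA : ∀ x, x ∉ A → f x = 0) :
    h ^ 2 * piInner π f f ^ 2 ≤ dirichletForm π P f * (2 * piInner π f f - dirichletForm π P f) := by
  -- the co-area bound for `ψ = f²`
  have hψ : ∀ x, 0 ≤ f x ^ 2 := fun x => sq_nonneg _
  have hψA : ∀ x, x ∉ A → f x ^ 2 = 0 := fun x hx => by rw [hfA x hx]; ring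
  have h13 := GoelMontenegroTetali2006_coarea_lower_abs hP hst hcut hψ hψA
  have hE : ∑ x, π x * f x ^ 2 = piInner π f f := by
    unfold piInner; exact sum_congr rfl fun x _ => by rw [sq]
  rw [hE] at h13
  -- `|f(x)² − f(y)²| = |f(x) − f(y)|·(f(x) + f(y))`
  have habs : ∀ x y, |f x ^ 2 - f y ^ 2| = |f x - f y| * (f x + f y) := by
    intro x y
    rw [sq_sub_sq, abs_mul, abs_of_nonneg (add_nonneg (hf x) (hf y)), mul_comm]
  simp_rw [habs] at h13
  -- square the inequality
  have hA0 : 0 ≤ h * piInner π f f :=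
    mul_nonneg hh (sum_nonneg fun x _ => mul_nonneg (hπ0 x) (mul_self_nonneg _))
  have hsq := pow_le_pow_left₀ hA0 h13 2
  -- Cauchy–Schwarz on the double sum, as a sum over `X × X`
  have hCS : (∑ x, ∑ y, π x * P x y * (|f x - f y| * (f x + f y))) ^ 2 ≤
      (∑ x, ∑ y, π x * P x y * (f x - f y) ^ 2) * ∑ x, ∑ y, π x * P x y * (f x + f y) ^ 2 := by
    rw [← Fintype.sum_prod_type' (fun x y => π x * P x y * (|f x - f y| * (f x + f y))),
      ← Fintype.sum_prod_type' (fun x y => π x * P x y * (f x - f y) ^ 2),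
      ← Fintype.sum_prod_type' (fun x y => π x * P x y * (f x + f y) ^ 2)]
    refine sum_sq_le_sum_mul_sum_of_sq_le_mul univ
      (fun p _ => mul_nonneg (mul_nonneg (hπ0 p.1) (hP.1 p.1 p.2)) (sq_nonneg _))
      (fun p _ => mul_nonneg (mul_nonneg (hπ0 p.1) (hP.1 p.1 p.2)) (sq_nonneg _))
      (fun p _ => le_of_eq ?_)
    simp only [mul_pow, sq_abs]
    ring
  -- the two factors: `Σ(f(x)−f(y))²Q = 2𝓔`, `Σ(f(x)+f(y))²Q = 4‖f‖² − 2𝓔`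
  have hF1 : ∑ x, ∑ y, π x * P x y * (f x - f y) ^ 2 = 2 * dirichletForm π P f := by
    unfold dirichletForm; ring
  have hleft : ∑ x, ∑ y, π x * P x y * f x ^ 2 = piInner π f f := by
    unfold piInner
    refine sum_congr rfl fun x _ => ?_
    have : ∑ y, π x * P x y * f x ^ 2 = π x * f x ^ 2 * ∑ y, P x y := by
      rw [mul_sum]; exact sum_congr rfl fun y _ => by ring
    rw [this, hP.2 x, mul_one, sq]
  have hright : ∑ x, ∑ y, π x * P x y * f y ^ 2 = piInner π f f := by
    unfold piInner
    rw [sum_comm]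
    refine sum_congr rfl fun y _ => ?_
    rw [← sum_mul, hst y, sq]
  have hF2 : ∑ x, ∑ y, π x * P x y * (f x + f y) ^ 2 =
      4 * piInner π f f - 2 * dirichletForm π P f := by
    have h1 : ∀ x y, π x * P x y * (f x + f y) ^ 2 =
        2 * (π x * P x y * f x ^ 2) + 2 * (π x * P x y * f y ^ 2) -
          π x * P x y * (f x - f y) ^ 2 := fun x y => by ring
    simp_rw [h1, sum_sub_distrib, sum_add_distrib, ← mul_sum]
    rw [hleft, hright, hF1]
    ring
  rw [hF1, hF2] at hCS
  calc h ^ 2 * piInner π f f ^ 2 = (h * piInner π f f) ^ 2 := by ring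
    _ ≤ ((1 / 2) * ∑ x, ∑ y, π x * P x y * (|f x - f y| * (f x + f y))) ^ 2 := hsq
    _ = (1 / 4) * (∑ x, ∑ y, π x * P x y * (|f x - f y| * (f x + f y))) ^ 2 := by ring
    _ ≤ (1 / 4) * ((2 * dirichletForm π P f) * (4 * piInner π f f - 2 * dirichletForm π P f)) :=
        mul_le_mul_of_nonneg_left hCS (by norm_num)
    _ = dirichletForm π P f * (2 * piInner π f f - dirichletForm π P f) := by ring

/-- **LEMMA 2.4 (Goel–Montenegro–Tetali 2006), lower bound, set form, for `f ≥ 0`:** if `h ≥ 0`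
and `h·π(S) ≤ |∂S|` for every `S ⊆ A`, then **`(h²/2)‖f‖₂² ≤ 𝓔(f,f)`** for every `f ≥ 0` supported
in `A` ("`λ₀(A) = inf_{f ∈ c₀⁺(A)}𝓔(f,f)/π(f²) ≥ Φ²(π(A))/2`").  `P` row-stochastic, `πP = π`, `π ≥ 0`.
[cite: GoelMontenegroTetali2006, §2.2 Lemma 2.4 (lower bound)] -/
theorem GoelMontenegroTetali2006_lemma_2_4_lower_nonneg {P : X → X → ℝ} (hP : IsRowStochastic P)
    {π : X → ℝ} (hst : IsStationary π P) (hπ0 : ∀ x, 0 ≤ π x) {A : Finset X} {h : ℝ}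
    (hh : 0 ≤ h) (hcut : ∀ S : Finset X, S ⊆ A → h * ∑ x ∈ S, π x ≤ edgeMeasure π P S Sᶜ)
    {f : X → ℝ} (hf : ∀ x, 0 ≤ f x) (hfA : ∀ x, x ∉ A → f x = 0) :
    h ^ 2 / 2 * piInner π f f ≤ dirichletForm π P f := by
  have h1 := sq_setConductance_mul_sq_piInner_le hP hst hπ0 hh hcut hf hfA
  have hE0 : 0 ≤ dirichletForm π P f := dirichletForm_nonneg hπ0 hP.1 f
  have hI0 : 0 ≤ piInner π f f := sum_nonneg fun x _ => mul_nonneg (hπ0 x) (mul_self_nonneg _)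
  rcases hI0.eq_or_lt with h0 | h0
  · rw [← h0, mul_zero]; exact hE0
  · have h2 : h ^ 2 / 2 * piInner π f f * piInner π f f ≤ dirichletForm π P f * piInner π f f := by
      nlinarith [sq_nonneg (dirichletForm π P f)]
    exact le_of_mul_le_mul_right h2 h0

/-- **LEMMA 2.4 (Goel–Montenegro–Tetali 2006), lower bound `Φ²(π(A))/2 ≤ λ₀(A)`, set form:** if
`h ≥ 0` and **`h·π(S) ≤ |∂S| = Q(S,Sᶜ)` for every `S ⊆ A`**, then **`(h²/2)‖f‖₂² ≤ 𝓔(f,f)` for EVERY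
`f` supported in `A`** ("for general `f ∈ c₀(A)`, `𝓔(f,f) ≥ 𝓔(|f|,|f|)` and `π(f²) = π(|f|²)`").
With `h = Φ(π(A))` this is the printed `λ₀(A) ≥ Φ²(π(A))/2`; minimising over `A` with `π(A) ≤ r`,
`Λ(r) ≥ Φ(r)²/2`.  `P` row-stochastic, `πP = π`, `π ≥ 0`; no reversibility.
[cite: GoelMontenegroTetali2006, §2.2 Lemma 2.4 (lower bound) and Remark 2.1] -/
theorem GoelMontenegroTetali2006_lemma_2_4_lower {P : X → X → ℝ} (hP : IsRowStochastic P)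
    {π : X → ℝ} (hst : IsStationary π P) (hπ0 : ∀ x, 0 ≤ π x) {A : Finset X} {h : ℝ}
    (hh : 0 ≤ h) (hcut : ∀ S : Finset X, S ⊆ A → h * ∑ x ∈ S, π x ≤ edgeMeasure π P S Sᶜ)
    {f : X → ℝ} (hfA : ∀ x, x ∉ A → f x = 0) :
    h ^ 2 / 2 * piInner π f f ≤ dirichletForm π P f := by
  have h1 := GoelMontenegroTetali2006_lemma_2_4_lower_nonneg hP hst hπ0 hh hcut
    (f := fun x => |f x|) (fun x => abs_nonneg _) (fun x hx => by simp [hfA x hx])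
  have hE : piInner π (fun x => |f x|) (fun x => |f x|) = piInner π f f := by
    unfold piInner; exact sum_congr rfl fun x _ => by rw [← sq, sq_abs, sq]
  rw [hE] at h1
  exact h1.trans (dirichletForm_abs_le hπ0 hP.1 f)

end Literature.Probability.MarkovChains
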